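import Summits.AtomisticToContinuum.FouriersLaw.Theses.LocalOhmBV
import Mathlib.Analysis.Calculus.BumpFunction.Convolution
import Mathlib.Analysis.Calculus.BumpFunction.FiniteDimension

/-!
# Weighted smooth approximation of continuous observables and the soft half of the response limit

Helper file for stub `stub_finiteResponsePackage` (S2a) of the birth line of crux `LocalOhmBV.LocalOhm`
(item stmt-AtomisticToContinuum-12009), clause (a2) (existence of the first-order response limit for
merely CONTINUOUS polynomially bounded observables). The tree proves the response limit for `C²`
observables dominated by `e^{ϑH}` (`pinnedChain_linear_response_of_uniformMixing`) and the `O(δ)`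
closeness of the two-temperature steady state to the Gibbs state tested on such observables
(`LogDensity.ness_gibbs_integral_sub_le`). This file supplies the three soft steps that upgrade these to
continuous observables, on a finite-dimensional real normed space `E`:

* `exists_smooth_compactSupport_approx_of_weight` — a continuous `ψ` which is eventually small against
  a weight `w ≥ 1` (`|ψ| ≤ ε w` off a large ball, for every `ε`) is, for every `ε > 0`, within `ε w`
  EVERYWHERE of a smooth compactly supported function (smooth truncation, uniform continuity,
  mollification by a normed bump: `ContDiffBump.dist_normed_convolution_le`);
  `far_decay_of_polyBound` — polynomially bounded `ψ` are eventually small against any weight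
  dominating one more power of `1 + ‖z‖`;
* `abs_integral_sub_le_of_contDiff_two` — an estimate `|∫ φ dν - ∫ φ dμ₀| ≤ K` valid for all `C²`
  observables `|φ| ≤ w` extends to `|∫ g dν - ∫ g dμ₀| ≤ K B` for continuous `|g| ≤ B w` of the above
  kind (both measures integrating `w`);
* `exists_tendsto_of_forall_approx` — a real function that is, for every `ε`, eventually `ε`-close to
  a function having a limit along a filter has a limit itself (Cauchy criterion).

No definitions; nothing here is specific to the chain.
-/

set_option autoImplicit false

noncomputable section

namespace Summit.AtomisticToContinuum.FouriersLaw.Theorems.LocalOhmBirth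

open MeasureTheory Filter Topology Set Metric
open scoped BigOperators ContDiff Convolution

section Approximation

variable {E : Type*} [NormedAddCommGroup E] [NormedSpace ℝ E] [FiniteDimensional ℝ E]
  [MeasurableSpace E] [BorelSpace E]

/-- **Weighted smooth approximation.** Let `w ≥ 1` and let `ψ : E → ℝ` be continuous and eventually
small against `w` (for every `ε > 0`, `|ψ z| ≤ ε w(z)` outside some ball). Then for every `ε > 0`
there is a smooth compactly supported `φ` with `|ψ - φ| ≤ ε w` everywhere: truncate `ψ` smoothly
outside a large ball, and mollify the (uniformly continuous) truncation. [folklore] -/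
theorem exists_smooth_compactSupport_approx_of_weight {ψ w : E → ℝ} (hψ : Continuous ψ)
    (hw : ∀ z, 1 ≤ w z) (hfar : ∀ ε : ℝ, 0 < ε → ∃ R : ℝ, ∀ z, R ≤ ‖z‖ → |ψ z| ≤ ε * w z)
    {ε : ℝ} (hε : 0 < ε) :
    ∃ φ : E → ℝ, ContDiff ℝ ∞ φ ∧ HasCompactSupport φ ∧ ∀ z, |ψ z - φ z| ≤ ε * w z := by
  obtain ⟨R, hR⟩ := hfar (ε / 2) (half_pos hε)
  -- smooth cutoff equal to one on the closed ball of radius `max R 0 + 1`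
  set R' : ℝ := max R 0 + 1 with hR'
  have hR'0 : 0 < R' := by positivity
  let χ : ContDiffBump (0 : E) := ⟨R', R' + 1, hR'0, by linarith⟩
  set g : E → ℝ := fun z => χ z * ψ z with hg
  have hgc : Continuous g := χ.continuous.mul hψ
  have hgs : HasCompactSupport g := χ.hasCompactSupport.mul_right
  -- uniform continuity of the truncated observable
  have hgu : UniformContinuous g := hgs.uniformContinuous_of_continuous hgc
  obtain ⟨r, hr, hru⟩ := Metric.uniformContinuous_iff.1 hgu (ε / 2) (half_pos hε)
  -- mollification at scale `r`
  set μ : Measure E := Measure.addHaar with hμ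
  let ρ : ContDiffBump (0 : E) := ⟨r / 2, r, half_pos hr, half_lt_self hr⟩
  set φ : E → ℝ := ρ.normed μ ⋆[ContinuousLinearMap.lsmul ℝ ℝ, μ] g with hφ
  refine ⟨φ, ?_, ?_, fun z => ?_⟩
  · exact ρ.hasCompactSupport_normed.contDiff_convolution_left _ ρ.contDiff_normed hgc.locallyIntegrable
  · exact ρ.hasCompactSupport_normed.convolution _ hgs
  · have h1 : |g z - φ z| ≤ ε / 2 := by
      have h := ContDiffBump.dist_normed_convolution_le (φ := ρ) (μ := μ) (x₀ := z) (ε := ε / 2)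
        hgc.aestronglyMeasurable fun x hx => (hru (mem_ball.1 hx)).le
      rw [Real.dist_eq] at h
      rwa [abs_sub_comm]
    have h2 : |ψ z - g z| ≤ ε / 2 * w z := by
      by_cases hz : ‖z‖ < R'
      · have h1 : χ z = 1 := χ.one_of_mem_closedBall (by simpa using hz.le)
        have : ψ z - g z = 0 := by rw [hg]; simp [h1]
        rw [this, abs_zero]
        have := hw z
        positivity
      · push Not at hz
        have hψz : |ψ z| ≤ ε / 2 * w z := hR z (by linarith [le_max_left R 0])
        have hχ0 : 0 ≤ χ z := χ.nonneg
        have hχ1 : χ z ≤ 1 := χ.le_one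
        have e : ψ z - g z = (1 - χ z) * ψ z := by rw [hg]; ring
        rw [e, abs_mul, abs_of_nonneg (by linarith)]
        calc (1 - χ z) * |ψ z| ≤ 1 * |ψ z| := mul_le_mul_of_nonneg_right (by linarith) (abs_nonneg _)
          _ ≤ ε / 2 * w z := by rw [one_mul]; exact hψz
    have h3 : ε / 2 ≤ ε / 2 * w z := by
      have := hw z
      nlinarith
    calc |ψ z - φ z| ≤ |ψ z - g z| + |g z - φ z| := abs_sub_le _ _ _
      _ ≤ ε / 2 * w z + ε / 2 * w z := add_le_add h2 (h1.trans h3)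
      _ = ε * w z := by ring

omit [NormedSpace ℝ E] [FiniteDimensional ℝ E] [MeasurableSpace E] [BorelSpace E] in
/-- A polynomially bounded function is eventually small against any weight dominating one more power
of `1 + ‖z‖`. [folklore] -/
theorem far_decay_of_polyBound {ψ w : E → ℝ} {C₀ A : ℝ} {m : ℕ}
    (hψ : ∀ z, |ψ z| ≤ C₀ * (1 + ‖z‖) ^ m) (hA0 : 0 < A) (hA : ∀ z, (1 + ‖z‖) ^ (m + 1) ≤ A * w z)
    {ε : ℝ} (hε : 0 < ε) :
    ∃ R : ℝ, ∀ z, R ≤ ‖z‖ → |ψ z| ≤ ε * w z := by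
  have hC : 0 ≤ C₀ := by
    have h := (abs_nonneg _).trans (hψ 0)
    exact nonneg_of_mul_nonneg_left h (by positivity)
  have hw : ∀ z, 0 ≤ w z := fun z => by
    have h : 0 < A * w z := lt_of_lt_of_le (by positivity) (hA z)
    exact (pos_of_mul_pos_right h hA0.le).le
  refine ⟨C₀ * A / ε, fun z hz => ?_⟩
  have h1 : C₀ * A ≤ ε * (1 + ‖z‖) := by
    rw [div_le_iff₀ hε] at hz
    nlinarith [norm_nonneg z]
  have key : C₀ * (1 + ‖z‖) ^ m * (1 + ‖z‖) ≤ ε * w z * (1 + ‖z‖) := by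
    calc C₀ * (1 + ‖z‖) ^ m * (1 + ‖z‖) = C₀ * (1 + ‖z‖) ^ (m + 1) := by ring
      _ ≤ C₀ * (A * w z) := mul_le_mul_of_nonneg_left (hA z) hC
      _ = (C₀ * A) * w z := by ring
      _ ≤ (ε * (1 + ‖z‖)) * w z := mul_le_mul_of_nonneg_right h1 (hw z)
      _ = ε * w z * (1 + ‖z‖) := by ring
  exact (hψ z).trans (le_of_mul_le_mul_right key (by positivity))

/-- **From `C²` test observables to continuous ones.** If two finite measures `ν, μ₀` on `E` integrate
the continuous weight `w ≥ 1` and `|∫ φ dν - ∫ φ dμ₀| ≤ K` for every `C²` observable `|φ| ≤ w`, then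
`|∫ g dν - ∫ g dμ₀| ≤ K B` for every continuous `g` with `|g| ≤ B w` which is eventually small against
`w` (weighted smooth approximation and `ε → 0`). [folklore] -/
theorem abs_integral_sub_le_of_contDiff_two {ν μ₀ : Measure E} {w : E → ℝ}
    (hw1 : ∀ z, 1 ≤ w z) (hwν : Integrable w ν) (hwμ : Integrable w μ₀) {K : ℝ} (hK : 0 ≤ K)
    (hC2 : ∀ φ : E → ℝ, ContDiff ℝ 2 φ → (∀ z, |φ z| ≤ w z) →
      |(∫ z, φ z ∂ν) - ∫ z, φ z ∂μ₀| ≤ K)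
    {g : E → ℝ} (hg : Continuous g)
    (hfar : ∀ ε : ℝ, 0 < ε → ∃ R : ℝ, ∀ z, R ≤ ‖z‖ → |g z| ≤ ε * w z)
    {B : ℝ} (hB : 0 ≤ B) (hgB : ∀ z, |g z| ≤ B * w z) :
    |(∫ z, g z ∂ν) - ∫ z, g z ∂μ₀| ≤ K * B := by
  refine le_of_forall_pos_lt_add fun η hη => ?_
  set W : ℝ := (∫ z, w z ∂ν) + ∫ z, w z ∂μ₀ with hW
  have hw0 : ∀ z, 0 ≤ w z := fun z => zero_le_one.trans (hw1 z)
  have hW0 : 0 ≤ W := add_nonneg (integral_nonneg hw0) (integral_nonneg hw0)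
  set ε : ℝ := η / (K + W + 1) with hε
  have hε0 : 0 < ε := by positivity
  have hεη : ε * (K + W) < η := by
    rw [hε, div_mul_eq_mul_div, div_lt_iff₀ (by positivity)]
    nlinarith
  obtain ⟨φ, hφs, hφc, hφε⟩ := exists_smooth_compactSupport_approx_of_weight hg hw1 hfar hε0
  have hφ2 : ContDiff ℝ 2 φ := hφs.of_le (by norm_cast)
  have hφcont : Continuous φ := hφs.continuous
  -- the `C²` estimate for `φ / (B + ε)`
  have hBε : 0 < B + ε := by positivity
  have hφB : ∀ z, |φ z| ≤ (B + ε) * w z := fun z => by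
    have h1 := hgB z
    have h2 := hφε z
    have h3 : |φ z| ≤ |g z| + |g z - φ z| := by
      have := abs_sub_abs_le_abs_sub (φ z) (g z)
      rw [abs_sub_comm] at this
      linarith
    nlinarith
  have h1 : |(∫ z, φ z ∂ν) - ∫ z, φ z ∂μ₀| ≤ K * (B + ε) := by
    have h := hC2 (fun z => φ z / (B + ε)) (hφ2.div_const _) fun z => by
      rw [abs_div, abs_of_pos hBε, div_le_iff₀ hBε, mul_comm]
      exact hφB z
    rw [integral_div, integral_div, ← sub_div, abs_div, abs_of_pos hBε, div_le_iff₀ hBε] at h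
    exact h
  -- the two approximation errors
  have hgi : ∀ {m : Measure E}, Integrable w m → Integrable g m := fun hm =>
    (hm.const_mul B).mono' hg.aestronglyMeasurable (Eventually.of_forall fun z => by
      rw [Real.norm_eq_abs]; exact hgB z)
  have hφi : ∀ {m : Measure E}, Integrable w m → Integrable φ m := fun hm =>
    (hm.const_mul (B + ε)).mono' hφcont.aestronglyMeasurable (Eventually.of_forall fun z => by
      rw [Real.norm_eq_abs]; exact hφB z)
  have herr : ∀ {m : Measure E}, Integrable w m →
      |(∫ z, g z ∂m) - ∫ z, φ z ∂m| ≤ ε * ∫ z, w z ∂m := by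
    intro m hm
    rw [← integral_sub (hgi hm) (hφi hm), ← integral_const_mul, ← Real.norm_eq_abs]
    exact norm_integral_le_of_norm_le (hm.const_mul ε) (Eventually.of_forall fun z => by
      rw [Real.norm_eq_abs]; exact hφε z)
  have h2 := herr hwν
  have h3 := herr hwμ
  calc |(∫ z, g z ∂ν) - ∫ z, g z ∂μ₀|
      ≤ |(∫ z, g z ∂ν) - ∫ z, φ z ∂ν| + |(∫ z, φ z ∂ν) - ∫ z, φ z ∂μ₀| +
          |(∫ z, φ z ∂μ₀) - ∫ z, g z ∂μ₀| := by
        have a := abs_sub_le (∫ z, g z ∂ν) (∫ z, φ z ∂ν) (∫ z, g z ∂μ₀)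
        have b := abs_sub_le (∫ z, φ z ∂ν) (∫ z, φ z ∂μ₀) (∫ z, g z ∂μ₀)
        linarith
    _ ≤ ε * (∫ z, w z ∂ν) + K * (B + ε) + ε * ∫ z, w z ∂μ₀ := by
        rw [abs_sub_comm (∫ z, φ z ∂μ₀)]
        exact add_le_add (add_le_add h2 h1) h3
    _ = K * B + ε * (K + W) := by rw [hW]; ring
    _ < K * B + η := by linarith

end Approximation

/-- **A limit from `ε`-approximants (Cauchy criterion).** If for every `ε > 0` the real function `F` is
eventually (along a non-trivial filter `l`) within `ε` of a function having a limit along `l`, then `F`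
has a limit along `l`. [folklore] -/
theorem exists_tendsto_of_forall_approx {α : Type*} {l : Filter α} [l.NeBot] {F : α → ℝ}
    (h : ∀ ε : ℝ, 0 < ε → ∃ G : α → ℝ, (∃ ρ : ℝ, Tendsto G l (𝓝 ρ)) ∧ ∀ᶠ a in l, |F a - G a| ≤ ε) :
    ∃ ρ : ℝ, Tendsto F l (𝓝 ρ) := by
  refine cauchy_map_iff_exists_tendsto.1 ?_
  rw [Metric.cauchy_iff]
  refine ⟨inferInstance, fun ε hε => ?_⟩
  obtain ⟨G, ⟨ρ, hρ⟩, hG⟩ := h (ε / 8) (by positivity)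
  have hρ' : ∀ᶠ a in l, dist (G a) ρ < ε / 8 := Metric.tendsto_nhds.1 hρ _ (by positivity)
  refine ⟨F '' {a | |F a - G a| ≤ ε / 8 ∧ dist (G a) ρ < ε / 8}, image_mem_map (hG.and hρ'), ?_⟩
  rintro _ ⟨a, ⟨ha1, ha2⟩, rfl⟩ _ ⟨b, ⟨hb1, hb2⟩, rfl⟩
  rw [Real.dist_eq] at ha2 hb2 ⊢
  have e1 := abs_sub_le (F a) (G a) (F b)
  have e2 := abs_sub_le (G a) ρ (F b)
  have e3 := abs_sub_le ρ (G b) (F b)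
  rw [abs_sub_comm ρ (G b)] at e3
  rw [abs_sub_comm (G b) (F b)] at e3
  linarith

/-- **Cauchy criterion at `δ → 0`, `δ ≠ 0`** (the form used for response limits): a real function of
`δ` that is, for every `ε > 0`, eventually within `ε` of a function having a limit as `δ → 0`, `δ ≠ 0`,
has a limit itself. [folklore] -/
theorem exists_tendsto_nhdsNE_zero_of_forall_approx :
    ∀ F : ℝ → ℝ, (∀ ε : ℝ, 0 < ε → ∃ G : ℝ → ℝ, (∃ ρ : ℝ, Tendsto G (𝓝[≠] (0 : ℝ)) (𝓝 ρ)) ∧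
      Filter.Eventually (fun δ => |F δ - G δ| ≤ ε) (𝓝[≠] (0 : ℝ))) →
      ∃ ρ : ℝ, Tendsto F (𝓝[≠] (0 : ℝ)) (𝓝 ρ) :=
  fun _ h => exists_tendsto_of_forall_approx h

end Summit.AtomisticToContinuum.FouriersLaw.Theorems.LocalOhmBirth

end
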